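import Summits.CriticalPhenomena.PercolationContinuityZ3.Theorems.Transplant.PlanarSkeletonDefs
import Summits.CriticalPhenomena.PercolationContinuityZ3.Theorems.Transplant.HeisenbergZSymmetry
import Summits.CriticalPhenomena.PercolationContinuityZ3.Theorems.Transplant.HeisenbergPlanarSkeleton
import HarnessLib

/-!
# `H₃(ℤ) × ℤ` carries a planar skeleton; `θ_{H₃×ℤ}(p_c) = 0` from the lane's node plus ONE named residue
# (the thick-fibre cylinder input `HeisenbergZCylSubcritical`)

builds on p205010 (kernel theorem, internal audit signed; external expert review pending).
Status sentence (coordinator 2026-08-20T04:30Z): "θ(p_c) = 0 on ℤ^d, all d ≥ 2 — kernel-verified (Lean 4/Mathlib,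
standard axioms); internal adversarial audit SIGNED 2026-08-20 04:29Z; external expert review pending."

Lane `prim-bschramm`, seat `prim-bschramm-p4` (gen 2; class map / abstract closing argument), helper file
(`--supports stmt-CriticalPhenomena-4575`).  The lane's second-tier rung R3a (`H₃(ℤ) × ℤ`, LADDER A3) was recorded as
"needs the two-orbit steering lemma D′".  This file puts it on the TYPED ladder of the planar-skeleton node instead:

* `hzSkeleton : PlanarSkeleton heisenbergZGraph` — `φ = hzAb = (a,b)`, base vertex `1`, frames = left translations `hzLeftIso`,
  point group `hzPointIso` (`HeisenbergZSymmetry.lean`); its cylinders are `hzCyl ℓ = {|a| ≤ ℓ, |b| ≤ ℓ}` (`hzSkeleton_cyl`),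
  which contain with each point its whole central coset `⟨C, T⟩ ≅ ℤ²` (`hzMul_central_mem_hzCyl`) — a THICK fibre: neither the
  bounded-cutset lemma (p207782, used for `H₃`) nor Martineau–Severo's Cor. 2.2 (used for the tubes of `X □ ℤ²`, p211018) applies;
* `HeisenbergZCylSubcritical` — THE residue of this rung (`@[conjecture]`, never asserted): no cylinder `hzCyl ℓ` percolates at
  `p_c(H₃ × ℤ)`.  It is NECESSARY (`cylSubcritical_of_continuity`) and, together with the lane's single node
  `SamePWitnessOfSkeleton`, SUFFICIENT: **`heisenbergZCriticalContinuity_of_skeletonNode_of_cylSubcritical`**; given the node the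
  target is EQUIVALENT to the residue (`heisenbergZCriticalContinuity_iff_cylSubcritical`).
Nothing is claimed about the node or the residue.  In print the residue is open: the general strict-inequality tool,
Martineau–Severo 2019 Thm. 2.1 / Cor. 2.2–2.3, needs a covering with tame fibres or a free action with quasi-transitive quotient
moving the cylinder off itself, and `H₃(ℤ) × ℤ` has neither for these cylinders; their Questions 3.1–3.2 (ibid. §3) mark the frontier.
[cite: BenjaminiSchramm1996, Conj. 4] [cite: KozmaNitzan2024, §4 p. 15; §1 p. 2 (approach 1)] [cite: MartineauSevero2019, Cor. 2.2; §3 Questions 3.1–3.2]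
[cite: LyonsPeres2016, Thm. 7.6]
-/

noncomputable section

namespace Summit.CriticalPhenomena.PercolationContinuityZ3.Theorems.Transplant

open MeasureTheory Literature.Probability.Percolation Literature.Probability.LatticeModels
open Literature.Probability.Percolation.GM
open Literature.Barriers.CriticalPhenomena (IsQuasiTransitive IsGraphAmenable)
open HeisenbergZ

/-! ## The skeleton, its cylinders, and why their fibres are thick -/

/-- **The planar skeleton of `H₃(ℤ) × ℤ`**: `φ = hzAb`, base vertex `1`, frames the left translations, point group `hzPointIso`.
[cite: KozmaNitzan2024, §4 p. 15] [cite: CheegerKleinerNaor2011, §1.1] -/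
def hzSkeleton : PlanarSkeleton heisenbergZGraph where
  φ := hzAb
  lip := fun _ _ h i => abs_hzAb_sub_le_one h i
  types := {(0 : HZ)}
  frame := fun v => ⟨0, Finset.mem_singleton_self _, hzLeftIso v, by simp, fun w => by
    rw [hzLeftIso_apply, hzAb_hzMul, hzAb_zero, sub_zero, add_comm]⟩
  point := fun t ht g => by
    rw [Finset.mem_singleton] at ht
    subst ht
    refine ⟨hzPointIso g, hzPointIso_zero g, fun w => ?_⟩
    rw [hzAb_zero, sub_zero, sub_zero, hzAb_hzPointIso]

/-- The cylinder `{|a| ≤ ℓ, |b| ≤ ℓ}` of `H₃(ℤ) × ℤ` (all `c`, all `t`). [cite: KozmaNitzan2024, §4 p. 15 (boxes)] -/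
def hzCyl (ℓ : ℕ) : Set HZ := {x | |x 0| ≤ ℓ ∧ |x 1| ≤ ℓ}

/-- `1 ∈ hzCyl ℓ`. [folklore] -/
theorem zero_mem_hzCyl (ℓ : ℕ) : (0 : HZ) ∈ hzCyl ℓ := by
  constructor <;> simp

/-- The skeleton's cylinders at the base vertex are the `hzCyl ℓ`. [folklore] -/
theorem hzSkeleton_cyl (ℓ : ℕ) : hzSkeleton.cyl (0 : HZ) ℓ = hzCyl ℓ := by
  ext x
  simp only [PlanarSkeleton.mem_cyl, hzCyl, Set.mem_setOf_eq]
  change hzAb x - hzAb 0 ∈ box 2 ℓ ↔ _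
  rw [hzAb_zero, sub_zero, mem_box]
  simp only [Fin.forall_fin_two, hzAb_apply_zero, hzAb_apply_one, abs_le]

/-- **Thick fibres**: left multiplication by any central element `(0,0,c,t)` preserves every cylinder, so each cylinder contains,
with any point, its whole coset of `⟨C, T⟩ ≅ ℤ²` — the cylinders have no bounded disjoint cutsets, and (this is the content of the
residue below) their subcriticality at `p_c` is not supplied by any tree tool. [folklore] -/
theorem hzMul_central_mem_hzCyl {ℓ : ℕ} (c t : ℤ) {x : HZ} : hzMul ![0, 0, c, t] x ∈ hzCyl ℓ ↔ x ∈ hzCyl ℓ := by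
  simp [hzCyl, hzMul]

/-! ## The residue and the conditional closure -/

/-- **THE RESIDUE OF RUNG R3a** (`H₃(ℤ) × ℤ`): no cylinder `{|a|,|b| ≤ ℓ}` percolates at `p_c(H₃(ℤ) × ℤ)` — the thick-fibre
instance of input Φ2 (`PlanarSkeleton.CylSubcritical`).  OPEN: an Aizenman–Grimmett-type strict inequality
`p_c(H₃ × ℤ) < p_c(G[hzCyl ℓ])` would give it; Martineau–Severo's covering criterion does not apply (no free subgroup moving the
cylinder off itself has a quasi-transitive quotient or tame fibres).  Never asserted. [cite: MartineauSevero2019, §3 Questions 3.1–3.2]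
[cite: AizenmanGrimmett1991, Thm. 1 (the ℤ^d model)] -/
@[conjecture]
def HeisenbergZCylSubcritical : Prop :=
  ∀ ℓ : ℕ, theta (heisenbergZGraph.induce (hzCyl ℓ)) ⟨0, zero_mem_hzCyl ℓ⟩ (criticalProbIOf heisenbergZGraph 0) = 0

/-- The residue is exactly input Φ2 of `hzSkeleton` at `p_c`. [folklore] -/
theorem hzSkeleton_cylSubcritical_of (hC : HeisenbergZCylSubcritical) :
    hzSkeleton.CylSubcritical (criticalProbIOf heisenbergZGraph 0) := by
  intro t ht ℓ
  have ht' : t = 0 := by simpa [hzSkeleton] using ht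
  subst ht'
  rw [theta_induce_congr heisenbergZGraph (hzSkeleton_cyl ℓ)]
  exact hC ℓ

/-- **The residue is NECESSARY**: `θ_{G[hzCyl ℓ]} ≤ θ_G`, so `θ_G(p_c) = 0` forces it. [folklore] -/
theorem cylSubcritical_of_continuity (h : HeisenbergZCriticalContinuity) : HeisenbergZCylSubcritical := by
  intro ℓ
  refine le_antisymm ?_ measureReal_nonneg
  calc theta (heisenbergZGraph.induce (hzCyl ℓ)) ⟨0, zero_mem_hzCyl ℓ⟩ (criticalProbIOf heisenbergZGraph 0)
      ≤ theta heisenbergZGraph 0 (criticalProbIOf heisenbergZGraph 0) :=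
        theta_induce_le_holds heisenbergZGraph (hzCyl ℓ) 0 (zero_mem_hzCyl ℓ) _
    _ = 0 := h

/-- **`θ_{H₃(ℤ)×ℤ}(p_c) = 0` from the lane's single node plus the one residue**: connected, quasi-transitive, amenable
(uniqueness by the tree's Burton–Keane), planar skeleton `hzSkeleton`, cylinders at `p_c` by `HeisenbergZCylSubcritical`.
Conditional on BOTH hypotheses; neither is claimed. [cite: BenjaminiSchramm1996, Conj. 4] [cite: KozmaNitzan2024, §1 p. 2 (approach 1)] -/
theorem heisenbergZCriticalContinuity_of_skeletonNode_of_cylSubcritical (hW : SamePWitnessOfSkeleton)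
    (hC : HeisenbergZCylSubcritical) : HeisenbergZCriticalContinuity := by
  unfold HeisenbergZCriticalContinuity
  exact continuity_of_skeleton_amenable hW heisenbergZGraph hzSkeleton heisenbergZGraph_connected
    heisenbergZGraph_quasiTransitive isGraphAmenable_heisenbergZ 0 (Finset.mem_singleton_self _)
    (hzSkeleton_cylSubcritical_of hC)

/-- **The rung in one line**: given the node, `θ_{H₃(ℤ)×ℤ}(p_c) = 0` is EQUIVALENT to the residue. [folklore] -/
theorem heisenbergZCriticalContinuity_iff_cylSubcritical (hW : SamePWitnessOfSkeleton) :
    HeisenbergZCriticalContinuity ↔ HeisenbergZCylSubcritical :=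
  ⟨cylSubcritical_of_continuity, heisenbergZCriticalContinuity_of_skeletonNode_of_cylSubcritical hW⟩

end Summit.CriticalPhenomena.PercolationContinuityZ3.Theorems.Transplant

end
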